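import Mathlib
import HarnessLib
import Summits.AtomisticToContinuum.FouriersLaw.Theses.JunctionLocality
import Summits.AtomisticToContinuum.FouriersLaw.Theorems.JunctionLocalitySuperadditiveResistanceStubKuboOnsager
import Summits.AtomisticToContinuum.FouriersLaw.Theorems.JunctionLocalitySuperadditiveResistanceKuboResolvent
import Summits.AtomisticToContinuum.FouriersLaw.Theorems.JunctionLocalitySuperadditiveResistanceStubDeviceForwardFieldsAux6

/-!
# Stubs S0b' and S0d' of skeleton v5 (κ-frame) of line `floating-probe-bypass-laplacian`
# (crux stmt-AtomisticToContinuum-11748)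

* `stub_deviceResolventFields` — for every split `N, M ≥ 2` and every `κ > 0` a family of `κ`-resolvent fields of the
  four terminals exists (choice over `a : Fin 4` of the landed `exists_deviceResolventField`, essential
  m-dissipativity of the device generator on `L²(μ_T)`).
* `stub_kuboDiagNonneg` — the `κ`-resolvent Kubo matrix has a nonnegative diagonal (positive semidefiniteness of the
  landed `kubo_onsager_resolvent` on the indicator vectors).

Vocabulary `termSite`, `kuboMatrix` from `…StubKuboOnsager`; `deviceResolventFields` declared here verbatim from the
skeleton. Standard axioms only.
-/

noncomputable section

open MeasureTheory Filter Topology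
open scoped ContDiff
open Literature.MathematicalPhysics.KineticTheory.HeatConduction
open Summit.AtomisticToContinuum.FouriersLaw.Theorems.SuperadditiveResistance.DeviceLiouville
open Summit.AtomisticToContinuum.FouriersLaw.Theorems.SuperadditiveResistance.Kubo

namespace Summit.AtomisticToContinuum.FouriersLaw.Cruxes.SuperadditiveResistance.FloatingProbeBypassLaplacian

/-- The set of `κ`-RESOLVENT FIELDS of the device's terminal observable at site `s`: classical `C²` solutions of
`κ g − L_dev g = p_s² − T` (all four thermostats at `T`), square integrable for `μ_T`. -/
def deviceResolventFields (ω₂ lam β γ T : ℝ) (N M : ℕ) (s : ℕ) (κ : ℝ) : Set (PhaseSpace (N + M) → ℝ) :=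
  {g | ContDiff ℝ 2 g ∧ MemLp g 2 ((pinnedChain ω₂ lam β γ).gibbsMeasure (N + M) T) ∧
    ∀ x, κ * g x - deviceGenerator (pinnedChain ω₂ lam β γ) N M (fun _ => T) g x = kin (N + M) s x - T}

/-- **S0b' — resolvent families exist (fixed-`N`), PROVED.** -/
theorem stub_deviceResolventFields :
    ∀ ω₂ lam β γ T : ℝ, 0 < ω₂ → 0 < lam → 0 < β → 0 < γ → 0 < T →
      ∀ N M : ℕ, 2 ≤ N → 2 ≤ M → ∀ κ : ℝ, 0 < κ → ∃ g : Fin 4 → PhaseSpace (N + M) → ℝ,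
        ∀ a : Fin 4, g a ∈ deviceResolventFields ω₂ lam β γ T N M (termSite N M a) κ := by
  intro ω₂ lam β γ T hω hl hβ hγ hT N M hN hM κ hκ
  have hNM : 0 < N + M := by omega
  have h : ∀ a : Fin 4, ∃ g : PhaseSpace (N + M) → ℝ,
      g ∈ deviceResolventFields ω₂ lam β γ T N M (termSite N M a) κ := by
    intro a
    obtain ⟨g, hgs, hgL, hpde⟩ := exists_deviceResolventField hω hl.le hβ.le hγ hT hNM (termSite N M a) hκ
    exact ⟨g, hgs.of_le (by norm_cast), hgL, hpde⟩
  choose g hg using h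
  exact ⟨g, hg⟩

/-- **S0d' — nonnegative diagonal of the resolvent Kubo matrix (fixed-`N`), PROVED.** -/
theorem stub_kuboDiagNonneg :
    ∀ ω₂ lam β γ T : ℝ, 0 < ω₂ → 0 < lam → 0 < β → 0 < γ → 0 < T →
      ∀ N M : ℕ, 2 ≤ N → 2 ≤ M → ∀ κ : ℝ, 0 < κ → ∀ g : Fin 4 → PhaseSpace (N + M) → ℝ,
        (∀ a : Fin 4, g a ∈ deviceResolventFields ω₂ lam β γ T N M (termSite N M a) κ) →
        ∀ a : Fin 4, 0 ≤ kuboMatrix ω₂ lam β γ T N M g a a := by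
  intro ω₂ lam β γ T hω hl hβ hγ hT N M hN hM κ hκ g hg a
  have hN1 : 1 ≤ N := by omega
  have hM1 : 1 ≤ M := by omega
  have hL : 0 < N + M := by omega
  set s := termFin N M hN1 hM1 with hs_def
  have hs : Function.Injective s := termFin_injective hN hM
  have hBw : deviceWeight N M = termWeight s := deviceWeight_eq_termWeight hN hM
  have hg2 : ∀ b, ContDiff ℝ 2 (g b) := fun b => (hg b).1
  have hgL : ∀ b, MemLp (g b) 2 ((pinnedChain ω₂ lam β γ).gibbsMeasure (N + M) T) := fun b => (hg b).2.1
  have hkin : ∀ (b : Fin 4) (x : PhaseSpace (N + M)), kin (N + M) (termSite N M b) x = x.2 (s b) ^ 2 :=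
    fun b x => kin_eq_sq (termSite_lt hN1 hM1 b) x
  have hpde : ∀ b x, (1 : ℝ) * liouvilleOp (pinnedChain ω₂ lam β γ) (N + M) (g b) x +
      γ * bathOp (N + M) (termWeight s) T (g b) x = -((x.2 (s b) ^ 2 - T) - κ * g b x) := by
    intro b x
    have e := (hg b).2.2 x
    have hγP : (pinnedChain ω₂ lam β γ).γ = γ := rfl
    rw [hkin b x, deviceGenerator_eq, hBw, hγP] at e
    linarith
  have hK : ∀ b c, kuboMatrix ω₂ lam β γ T N M g b c = (if b = c then γ else 0) -
      γ ^ 2 / T ^ 2 * ∫ x, g b x * (x.2 (s c) ^ 2 - T) ∂((pinnedChain ω₂ lam β γ).gibbsMeasure (N + M) T) := by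
    intro b c
    simp only [kuboMatrix, hkin c]
  obtain ⟨-, hpsd, -, -, -⟩ := kubo_onsager_resolvent hω hl.le hβ.le (N + M) hT s hs 1 hγ hκ.le hg2 hgL hpde
    (kuboMatrix ω₂ lam β γ T N M g) hK
  have h := hpsd fun b => if b = a then 1 else 0
  have e : ∑ b : Fin 4, ∑ c : Fin 4, (if b = a then (1 : ℝ) else 0) * kuboMatrix ω₂ lam β γ T N M g b c *
      (if c = a then 1 else 0) = kuboMatrix ω₂ lam β γ T N M g a a := by
    simp [Finset.sum_ite_eq', ite_mul, mul_ite]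
  rw [e] at h
  exact h

end Summit.AtomisticToContinuum.FouriersLaw.Cruxes.SuperadditiveResistance.FloatingProbeBypassLaplacian

end
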